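import Summits.KontsevichZagierPeriods.KontsevichZagierPeriods.Theorems.SoloBlindAngleCells
import HarnessLib

/-!
# The angle box `[(0,1)ᵏ, w]` and its `k!` order cells, in every dimension

With the angle weight `w(t) = ∏ᵢ W(tᵢ) = ∏ᵢ 2/(1+tᵢ²)` (`∏ dθᵢ` in half-angle tangents
`tᵢ = tan(θᵢ/2)`):

* the **angle box** `[(0,1)ᵏ, w]` is the `k`-th power of the open angle cell `[(0,1), 2/(1+t²)]`
  (`anglePow`), so its class is `(2·a(1))ᵏ` in `Q` (`mkQ_anglePow`; `2·a(1) = [π/2]`);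
* a **piece** `[E, w]` for a `ℚ`-semialgebraic `E ⊆ (0,1)ᵏ` (`angPiece`), in particular the open
  ordered simplex `[Δ_k, w]` (`simplexPieceK`) and its coordinate permutations, the **order cells**
  `[Δ_σ, w]` (`orderCellK σ`), each equivalent to `[Δ_k, w]` by a linear move;
* **dissection**: `[(0,1)ᵏ, w] − Σ_σ [Δ_σ, w] ∈ relations` (ties are null hyperplanes), hence
  `[(0,1)ᵏ, w] = k! · [Δ_k, w]` in `Q` (`mkQ_anglePow_eq`) and
  **`k! · [Δ_k, w] = (2·a(1))ᵏ`** (`factorial_nsmul_simplexPieceK`).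

This is the dimension-free version of `SoloBlindAngleBox` (`k = 4`).
-/

noncomputable section

namespace Summit.KontsevichZagierPeriods.KontsevichZagierPeriods.Theorems

open Set MeasureTheory
open Literature.ModelTheory.ExponentialFields (IsSemialgebraic)
open Literature.NumberTheory.Transcendental
open Literature.NumberTheory.Transcendental.KZ

namespace SoloBlind

variable {k : ℕ}

/-! ## The angle weight and the angle box -/

/-- The angle weight `w(t) = ∏ᵢ W(tᵢ)` in dimension `k`. -/
def angWeight (k : ℕ) (t : Fin k → ℝ) : ℝ := ∏ i, tW (t i)

/-- Unfolding the weight. -/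
theorem angWeight_eq (t : Fin k → ℝ) : angWeight k t = ∏ i, tW (t i) := rfl

/-- The weight is positive. -/
theorem angWeight_pos (t : Fin k → ℝ) : 0 < angWeight k t :=
  Finset.prod_pos fun i _ => tW_pos (t i)

/-- The weight is invariant under coordinate permutations. -/
theorem angWeight_perm (σ : Equiv.Perm (Fin k)) (t : Fin k → ℝ) :
    angWeight k (fun i => t (σ i)) = angWeight k t :=
  Fintype.prod_equiv σ (fun i => tW (t (σ i))) (fun i => tW (t i)) fun _ => rfl

/-- **The angle box** `[(0,1)ᵏ, w]`: the `k`-th power of the open angle cell `[(0,1), W]`. -/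
def anglePow : (k : ℕ) → IntegralRep k
  | 0 => constCell 1 isAlgebraic_one
  | k + 1 => (anglePow k).prod angleCellO

/-- The successor step of the angle box. -/
theorem anglePow_succ (k : ℕ) : anglePow (k + 1) = (anglePow k).prod angleCellO := rfl

/-- **The domain of the angle box is the open box `(0,1)ᵏ`.** -/
theorem anglePow_domain : ∀ k, (anglePow k).domain = kzOpenBox k
  | 0 => by
    ext z
    simp only [anglePow, constCell_domain, mem_univ, mem_kzOpenBox, IsEmpty.forall_iff]
  | k + 1 => by
    ext z
    have hl : Fin.natAdd k (0 : Fin 1) = Fin.last k := Fin.ext (by simp)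
    rw [anglePow_succ, IntegralRep.prod_domain, IntegralRep.mem_prodDomain, anglePow_domain k,
      mem_kzOpenBox, mem_kzOpenBox, Fin.forall_fin_succ']
    simp only [angleCellO, IntegralRep.domain_restrict, mem_line, hl]
    rfl

/-- **The integrand of the angle box is the angle weight.** -/
theorem anglePow_integrand : ∀ k, (anglePow k).integrand = angWeight k
  | 0 => by
    funext z
    simp [anglePow, angWeight]
  | k + 1 => by
    funext z
    have hl : Fin.natAdd k (0 : Fin 1) = Fin.last k := Fin.ext (by simp)
    rw [anglePow_succ, IntegralRep.prod_integrand_eq, IntegralRep.prodFun_apply,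
      anglePow_integrand k, angWeight_eq, angWeight_eq, Fin.prod_univ_castSucc]
    simp only [angleCellO, IntegralRep.integrand_restrict, angleCell_integrand, hl]
    rfl

/-- **`[(0,1)ᵏ, w] = (2·a(1))ᵏ` in `Q`** (rule: products). -/
theorem mkQ_anglePow : ∀ k, mkQ (of (anglePow k)) = ((2 : K₀) • alpha 1) ^ k
  | 0 => by rw [pow_zero, one_eq_mkQ]; rfl
  | k + 1 => by
    rw [anglePow_succ, ← of_mul_of, mkQ_mul, mkQ_anglePow k, mkQ_angleCellO, pow_succ]

/-! ## Pieces of the angle box -/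

section piece

variable (E : Set (Fin k → ℝ)) (hE : IsSemialgebraic ℚ E) (hsub : E ⊆ kzOpenBox k)

/-- The piece `[E, w]` of the angle box over a `ℚ`-semialgebraic `E ⊆ (0,1)ᵏ`. -/
def angPiece : IntegralRep k := (anglePow k).restrict E hE (by rw [anglePow_domain]; exact hsub)

/-- The domain of a piece. -/
@[simp] theorem angPiece_domain : (angPiece E hE hsub).domain = E := rfl

/-- The integrand of a piece is `w`. -/
@[simp] theorem angPiece_integrand : (angPiece E hE hsub).integrand = angWeight k :=
  anglePow_integrand k

end piece

/-- `Δ_k ⊆ (0,1)ᵏ`. -/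
theorem openOrderedSimplex_subset_kzOpenBoxK (k : ℕ) : openOrderedSimplex k ⊆ kzOpenBox k :=
  fun _ ht i => ⟨ht.1 i, ht.2.1 i⟩

/-- `[Δ_k, w]`: the open ordered simplex with the angle weight. -/
def simplexPieceK (k : ℕ) : IntegralRep k :=
  angPiece (openOrderedSimplex k) (isSemialgebraic_openOrderedSimplex k)
    (openOrderedSimplex_subset_kzOpenBoxK k)

/-! ## Dissection of the box into the `k!` order cells (ties are null: `SelbergLimit`) -/

/-- The order cell `Δ_σ = {t | t ∘ σ ∈ Δ_k}` with the angle weight: `[Δ_k, w]` re-indexed. -/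
def orderCellK (σ : Equiv.Perm (Fin k)) : IntegralRep k := (simplexPieceK k).reindex σ

/-- Membership in an order cell. -/
theorem mem_orderCellK_domain {σ : Equiv.Perm (Fin k)} {t : Fin k → ℝ} :
    t ∈ (orderCellK σ).domain ↔ (fun i => t (σ i)) ∈ openOrderedSimplex k := Iff.rfl

/-- The integrand of an order cell is `w` (symmetry of `w`). -/
theorem orderCellK_integrand (σ : Equiv.Perm (Fin k)) (t : Fin k → ℝ) :
    (orderCellK σ).integrand t = angWeight k t := by
  simp only [orderCellK, IntegralRep.reindex_integrand, simplexPieceK, angPiece_integrand]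
  exact angWeight_perm σ t

/-- Order cells lie in the box. -/
theorem orderCellK_domain_subset (σ : Equiv.Perm (Fin k)) :
    (orderCellK σ).domain ⊆ kzOpenBox k := by
  intro t ht i
  obtain ⟨hp, hl, -⟩ := mem_orderCellK_domain.mp ht
  simpa using And.intro (hp (σ.symm i)) (hl (σ.symm i))

/-- Distinct order cells are disjoint (a strictly decreasing rearrangement is unique). -/
theorem orderCellK_domain_disjoint {σ τ : Equiv.Perm (Fin k)} (h : σ ≠ τ) :
    (orderCellK σ).domain ∩ (orderCellK τ).domain = ∅ := by
  refine eq_empty_of_forall_notMem fun t ⟨hσ, hτ⟩ => h ?_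
  have h1 : StrictAnti (fun i => t (σ i)) := (mem_orderCellK_domain.mp hσ).2.2
  have h2 : StrictAnti (fun i => t (τ i)) := (mem_orderCellK_domain.mp hτ).2.2
  have hr : range (fun i => t (σ i)) = range (fun i => t (τ i)) := by
    rw [show (fun i => t (σ i)) = t ∘ σ from rfl, show (fun i => t (τ i)) = t ∘ τ from rfl,
      EquivLike.range_comp, EquivLike.range_comp]
  have heq := (h1.range_inj h2).mp hr
  refine Equiv.ext fun i => ?_
  have e1 : (fun j => t (σ j)) (σ.symm (τ i)) = (fun j => t (σ j)) i := by
    simp only [Equiv.apply_symm_apply]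
    exact (congrFun heq i).symm
  simpa using (congrArg σ (h1.injective e1)).symm

/-- A point of the box with distinct coordinates lies in an order cell (sort the coordinates). -/
theorem exists_mem_orderCellK {t : Fin k → ℝ} (ht : t ∈ kzOpenBox k)
    (hinj : Function.Injective t) : ∃ σ, t ∈ (orderCellK σ).domain := by
  refine ⟨Fin.revPerm.trans (Tuple.sort t), mem_orderCellK_domain.mpr
    ⟨fun i => (ht _).1, fun i => (ht _).2, fun a b hab => ?_⟩⟩
  have hmono : StrictMono (t ∘ Tuple.sort t) :=
    (Tuple.monotone_sort t).strictMono_of_injective (hinj.comp (Tuple.sort t).injective)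
  simp only [Equiv.trans_apply, Fin.revPerm_apply]
  exact hmono (Fin.rev_lt_rev.mpr hab)

/-- Off the tie hyperplanes `{tᵢ = tⱼ}` (a null set) every point of `E ⊆ (0,1)ᵏ` lies in SOME
order cell; if those cells are all listed in `S`, then `E ∖ ⋃_{σ ∈ S} Δ_σ` is null. -/
theorem volume_diff_orderCells_eq_zero {E : Set (Fin k → ℝ)} (hE : E ⊆ kzOpenBox k)
    (S : Finset (Equiv.Perm (Fin k)))
    (hS : ∀ t ∈ E, ∀ σ, t ∈ (orderCellK σ).domain → σ ∈ S) :
    volume (E \ ⋃ σ ∈ S, (orderCellK σ).domain) = 0 := by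
  refine measure_mono_null ?_
    (measure_iUnion_null_iff.mpr fun p : {p : Fin k × Fin k // p.1 ≠ p.2} =>
      Literature.Analysis.SpecialFunctions.Selberg.volume_setOf_apply_eq p.2)
  rintro t ⟨ht, hnot⟩
  simp only [mem_iUnion, not_exists] at hnot
  by_contra hties
  simp only [mem_iUnion, mem_setOf_eq, not_exists] at hties
  have hinj : Function.Injective t := fun i j hij => by
    by_contra hne
    exact hties ⟨(i, j), hne⟩ hij
  obtain ⟨σ, hσ⟩ := exists_mem_orderCellK (hE ht) hinj
  exact hnot σ (hS t ht σ hσ) hσ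

/-- **Dissection (rule (1))**: `[(0,1)ᵏ, w] − Σ_σ [Δ_σ, w] ∈ relations`. -/
theorem anglePow_sub_sum_orderCellK (k : ℕ) :
    of (anglePow k) - ∑ σ ∈ (Finset.univ : Finset (Equiv.Perm (Fin k))), of (orderCellK σ) ∈
      relations := by
  refine of_sub_sum_of_mem_relations Finset.univ (anglePow k) orderCellK
    (fun σ _ => measure_mono_null
      (fun t ht => (ht.2 ((anglePow_domain k).symm ▸ orderCellK_domain_subset σ ht.1)).elim)
      measure_empty)
    (fun σ _ t _ => by rw [orderCellK_integrand, anglePow_integrand]) ?_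
    (fun σ _ τ _ hστ => show volume ((orderCellK σ).domain ∩ (orderCellK τ).domain) = 0 by
      rw [orderCellK_domain_disjoint hστ, measure_empty])
  rw [anglePow_domain]
  exact volume_diff_orderCells_eq_zero subset_rfl _ fun _ _ σ _ => Finset.mem_univ σ

/-- Each order cell is a coordinate permutation of `[Δ_k, w]` (rule (2), linear chart). -/
theorem simplexPieceK_sub_orderCellK (σ : Equiv.Perm (Fin k)) :
    of (simplexPieceK k) - of (orderCellK σ) ∈ relations :=
  of_sub_of_reindex_mem_relations _ _

/-- A sum of order cells is a multiple of `[Δ_k, w]` in `Q`. -/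
theorem mkQ_sum_orderCellK (S : Finset (Equiv.Perm (Fin k))) :
    mkQ (∑ σ ∈ S, of (orderCellK σ)) = S.card • mkQ (of (simplexPieceK k)) := by
  have h : ∑ σ ∈ S, of (simplexPieceK k) - ∑ σ ∈ S, of (orderCellK σ) ∈ relations :=
    sum_sub_sum_mem_relations _ _ _ fun σ _ => simplexPieceK_sub_orderCellK σ
  rw [← mkQ_eq_mkQ_iff.mpr h, Finset.sum_const, map_nsmul]

/-- **`[(0,1)ᵏ, w] = k!·[Δ_k, w]` in `Q`.** -/
theorem mkQ_anglePow_eq (k : ℕ) :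
    mkQ (of (anglePow k)) = k.factorial • mkQ (of (simplexPieceK k)) := by
  rw [mkQ_eq_mkQ_iff.mpr (anglePow_sub_sum_orderCellK k), mkQ_sum_orderCellK, Finset.card_univ,
    Fintype.card_perm, Fintype.card_fin]

/-- **`k!·[Δ_k, w] = (2·a(1))ᵏ` in `Q`.** -/
theorem factorial_nsmul_simplexPieceK (k : ℕ) :
    k.factorial • mkQ (of (simplexPieceK k)) = ((2 : K₀) • alpha 1) ^ k := by
  rw [← mkQ_anglePow_eq, mkQ_anglePow]

end SoloBlind

end Summit.KontsevichZagierPeriods.KontsevichZagierPeriods.Theorems
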